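import Summits.CriticalPhenomena.PercolationContinuityZ3.Theorems.SahiMasterFamilyPhiVertex

/-!
# The DISJOINT-union vertex conjecture (V′) is a theorem, every order

Unit `prim-masterthm-p4` (gen 17; crux anchor stmt-CriticalPhenomena-4575, helper work; memo
`run/shared/lean/prim/prim-masterthm/prim-masterthm-p4/P4-GEN17-REPORT.md` §1).  Companion of `…PhiVertex` (gen 14), which
proved the vertex conjecture (V) at every order: for every union-closed family `𝒰 ∋ univ` of subsets of `Fin n`,
`Φ_n(1_𝒰) = Σ_{σ : all cycle supports ∈ 𝒰} (−1)^{#cycles(σ)−1} ≥ 0`.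

The census lane (ttrl, `run/shared/lean/ttrl/vconj/VCONJ.md`) also tracks the variant **(V′)**: the same inequality for families
closed under DISJOINT unions only (exhaustive `k ≤ 5`, branch-and-bound `k = 6`, `k = 7` undecided there).  (V′) is NOT a special
case of (V) (a disjoint-union-closed family need not be union-closed), and the interior analogue is false (`F′(6)`, gen 13 memo §3:
supermultiplicativity for disjoint pairs only does not give `Φ_6 ≥ 0`).  At the vertices, however, gen 14's five-line argument goes
through VERBATIM, because the blocks of a set partition are pairwise disjoint:

**THEOREM (this file, every order).** `phiSet_nonneg_of_zero_one_disj`: for every `k` and every `β : Finset (Fin (k+1)) → {0,1}`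
with `β univ = 1` and `β S · β T ≤ β (S ∪ T)` for all DISJOINT `S, T`, `Φ_{k+1}(β) ≥ 0`.  Equivalently
(`phiSet_indicator_nonneg_of_disjUnionClosed`, `sum_perm_sign_nonneg_of_disjUnionClosed`): for every family `𝒰` of subsets of
`Fin (n+1)` containing `univ` and closed under disjoint unions, `0 ≤ Σ_{σ : all cycle supports of σ lie in 𝒰} (−1)^{#cycles(σ) − 1}`.

PROOF.  Strong induction on the order through the abstract step `PrincipalCapStep.phiSet_nonneg_of_subfamilies` (block expansion
along the cycle through the last index; needs only `β ≤ 1`, `β univ = 1` and nonnegativity of the honest sub-functionals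
`Φ(β|_R)`, `R ∌ last`).  The restriction `β|_R` is again `0/1`-valued and disjoint-supermultiplicative (embeddings preserve
disjointness); if `β R = 1` it is an instance one order down; if `β R = 0` then every set partition of `R` has a block of value `0` —
its blocks are pairwise disjoint with union `R`, so `∏_{B∈π} β B ≤ β R = 0` (`prod_le_apply_biUnion_of_disjSupermul`) — and
`Φ(β|_R) = 0` exactly (`phiSet_eq_zero_of_univ_eq_zero_disj`).  HONEST FRAMING: a statement about the `0/1` points only; it does not
give `(UC-hull)_k`, `F^UC(k)`, Sahi's `C_k` (k ≥ 8 on the principal-cap stratum), Kahn's Conjecture 5 or the master theorem, which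
remain OPEN.  Axioms standard. [this work]
-/

noncomputable section

open scoped Classical

namespace Summit.CriticalPhenomena.PercolationContinuityZ3.Theorems

namespace PhiVertexDisjoint

open Finset Function
open Literature.Combinatorics.Sahi2008
open PrincipalCapBeta (phiSet)

variable {n : ℕ}

/-! ### Iterated disjoint supermultiplicativity and the vanishing lemma -/

/-- **Iterated DISJOINT supermultiplicativity.**  For a nonnegative set function with `β S · β T ≤ β (S ∪ T)` for disjoint `S, T`,
the product of the values on a nonempty finite family of pairwise disjoint sets is at most the value on their union. [this work] -/
theorem prod_le_apply_biUnion_of_disjSupermul (β : Finset (Fin n) → ℝ) (h0 : ∀ B, 0 ≤ β B)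
    (hsup : ∀ S T, Disjoint S T → β S * β T ≤ β (S ∪ T)) {κ : Type*} (B : κ → Finset (Fin n))
    (hB : ∀ i j, i ≠ j → Disjoint (B i) (B j)) :
    ∀ J : Finset κ, J.Nonempty → ∏ j ∈ J, β (B j) ≤ β (J.biUnion B) := by
  intro J
  induction J using Finset.induction_on with
  | empty => intro h; exact absurd h Finset.not_nonempty_empty
  | insert a s ha ih =>
    intro _
    rw [prod_insert ha, Finset.biUnion_insert]
    by_cases hs : s.Nonempty
    · have hdisj : Disjoint (B a) (s.biUnion B) := by
        rw [Finset.disjoint_biUnion_right]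
        intro j hj
        exact hB a j fun h => ha (h ▸ hj)
      calc β (B a) * ∏ j ∈ s, β (B j) ≤ β (B a) * β (s.biUnion B) :=
            mul_le_mul_of_nonneg_left (ih hs) (h0 _)
        _ ≤ β (B a ∪ s.biUnion B) := hsup _ _ hdisj
    · rw [not_nonempty_iff_eq_empty.1 hs, prod_empty, Finset.biUnion_empty, union_empty, mul_one]

/-- Distinct blocks of a set partition are disjoint. [folklore] -/
theorem disjoint_block (c : OrderedFinpartition n) {i j : Fin c.length} (h : i ≠ j) :
    Disjoint (PartitionForm.block c i) (PartitionForm.block c j) := by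
  unfold PartitionForm.block
  rw [Finset.disjoint_filter]
  intro x _ hi hj
  exact h (hi.symm.trans hj)

/-- **Vanishing lemma (disjoint version).**  If `β ≥ 0` is supermultiplicative on disjoint pairs and its top value is `0`, then
every set partition has a block of value `0`, so `Φ_{n+1}(β) = 0`. [this work] -/
theorem phiSet_eq_zero_of_univ_eq_zero_disj (β : Finset (Fin (n + 1)) → ℝ) (h0 : ∀ B, 0 ≤ β B)
    (hsup : ∀ S T, Disjoint S T → β S * β T ≤ β (S ∪ T)) (htop : β univ = 0) : phiSet (n + 1) β = 0 := by
  unfold PrincipalCapBeta.phiSet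
  refine sum_eq_zero fun c _ => ?_
  have hne : (univ : Finset (Fin c.length)).Nonempty := ⟨c.index 0, mem_univ _⟩
  have hle : ∏ j, β (PartitionForm.block c j) ≤ β univ := by
    have h := prod_le_apply_biUnion_of_disjSupermul β h0 hsup (PartitionForm.block c)
      (fun i j hij => disjoint_block c hij) univ hne
    rwa [PhiVertex.biUnion_block_eq_univ] at h
  have hge : 0 ≤ ∏ j, β (PartitionForm.block c j) := prod_nonneg fun j _ => h0 _
  have hz : ∏ j, β (PartitionForm.block c j) = 0 := le_antisymm (htop ▸ hle) hge
  rw [prod_mul_distrib, hz, mul_zero, mul_zero]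

/-! ### (V′): `Φ ≥ 0` at every disjoint-supermultiplicative `0/1` point, every order -/

/-- **THEOREM (V′), every order.**  For every `0/1`-valued set function `β` on `Finset (Fin (k+1))` with `β univ = 1` and
`β S · β T ≤ β (S ∪ T)` for all DISJOINT `S, T`:  `0 ≤ Φ_{k+1}(β)`. [this work] -/
theorem phiSet_nonneg_of_zero_one_disj : ∀ (k : ℕ) (β : Finset (Fin (k + 1)) → ℝ), (∀ B, β B = 0 ∨ β B = 1) →
    β univ = 1 → (∀ S T, Disjoint S T → β S * β T ≤ β (S ∪ T)) → 0 ≤ phiSet (k + 1) β := by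
  intro k
  induction k using Nat.strong_induction_on with
  | _ k ih =>
  intro β h01 huniv hsup
  have h0 : ∀ B, 0 ≤ β B := fun B => by rcases h01 B with h | h <;> simp [h]
  have h1 : ∀ B, β B ≤ 1 := fun B => by rcases h01 B with h | h <;> simp [h]
  refine PrincipalCapStep.phiSet_nonneg_of_subfamilies β h1 huniv fun m e he => ?_
  have h01' : ∀ B : Finset (Fin (m + 1)), β (B.map e) = 0 ∨ β (B.map e) = 1 := fun B => h01 _
  have h0' : ∀ B : Finset (Fin (m + 1)), 0 ≤ β (B.map e) := fun B => h0 _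
  have hsup' : ∀ S T : Finset (Fin (m + 1)), Disjoint S T →
      β (S.map e) * β (T.map e) ≤ β ((S ∪ T).map e) := fun S T hST => by
    rw [Finset.map_union]
    exact hsup _ _ ((Finset.disjoint_map e).2 hST)
  rcases h01' univ with hz | ho
  · exact le_of_eq (phiSet_eq_zero_of_univ_eq_zero_disj (fun S => β (S.map e)) h0' hsup' hz).symm
  · exact ih m (PhiVertex.lt_of_emb_ne_last e he) (fun S => β (S.map e)) h01' ho hsup'

/-- The same for every order `n ≥ 1`. [this work] -/
theorem phiSet_nonneg_of_zero_one_disj' (hn : 1 ≤ n) (β : Finset (Fin n) → ℝ) (h01 : ∀ B, β B = 0 ∨ β B = 1)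
    (huniv : β univ = 1) (hsup : ∀ S T, Disjoint S T → β S * β T ≤ β (S ∪ T)) : 0 ≤ phiSet n β := by
  obtain ⟨k, rfl⟩ := Nat.exists_eq_add_of_le' hn
  exact phiSet_nonneg_of_zero_one_disj k β h01 huniv hsup

/- (V′) contains (V): full supermultiplicativity is the special case `fun S T _ => hsup S T` — that instance is gen 14's
`PhiVertex.phiSet_nonneg_of_zero_one'` and is not restated here. -/

/-! ### The disjoint-union-closed-family form and the cycle form -/

/-- **(V′) for disjoint-union-closed families.**  If `𝒰` is a family of subsets of `Fin n` (`n ≥ 1`) closed under DISJOINT unions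
and containing `univ`, then `Φ_n(1_𝒰) ≥ 0`. [this work] -/
theorem phiSet_indicator_nonneg_of_disjUnionClosed (hn : 1 ≤ n) (𝒰 : Finset (Finset (Fin n)))
    (hU : ∀ A ∈ 𝒰, ∀ B ∈ 𝒰, Disjoint A B → A ∪ B ∈ 𝒰) (htop : univ ∈ 𝒰) :
    0 ≤ phiSet n (fun S => if S ∈ 𝒰 then 1 else 0) := by
  refine phiSet_nonneg_of_zero_one_disj' hn _ (fun B => ?_) (if_pos htop) (fun S T hST => ?_)
  · by_cases h : B ∈ 𝒰
    · exact Or.inr (if_pos h)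
    · exact Or.inl (if_neg h)
  · by_cases hS : S ∈ 𝒰
    · by_cases hT : T ∈ 𝒰
      · rw [if_pos hS, if_pos hT, if_pos (hU S hS T hT hST), mul_one]
      · rw [if_neg hT, mul_zero]; split_ifs <;> norm_num
    · rw [if_neg hS, zero_mul]; split_ifs <;> norm_num

/-- **(V′) in cycle form.**  For a family `𝒰` of subsets of `Fin (n+1)` containing `univ` and closed under disjoint unions:
`0 ≤ Σ_{σ ∈ S_{n+1} : every cycle support of σ lies in 𝒰} (−1)^{#cycles(σ) − 1}` — among the permutations all of whose cycles
lie in `𝒰`, those with an odd number of cycles are at least as many as those with an even number.  (This is the statement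
"`Psi(U) ≥ 0` for disjoint-union-closed `U ∋ [k]`", every `k`.) [this work] -/
theorem sum_perm_sign_nonneg_of_disjUnionClosed (𝒰 : Finset (Finset (Fin (n + 1))))
    (hU : ∀ A ∈ 𝒰, ∀ B ∈ 𝒰, Disjoint A B → A ∪ B ∈ 𝒰) (htop : univ ∈ 𝒰) :
    0 ≤ ∑ σ ∈ (univ : Finset (Equiv.Perm (Fin (n + 1)))).filter (fun σ => ∀ B ∈ CycleForm.orbits σ, B ∈ 𝒰),
      (-1 : ℝ) ^ ((CycleForm.orbits σ).card - 1) := by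
  have h := phiSet_indicator_nonneg_of_disjUnionClosed (Nat.succ_le_succ (Nat.zero_le n)) 𝒰 hU htop
  rw [PhiVertex.phiSet_eq_sum_perm,
    ← sum_filter_add_sum_filter_not univ (fun σ => ∀ B ∈ CycleForm.orbits σ, B ∈ 𝒰)] at h
  have hin : ∀ σ ∈ univ.filter (fun σ : Equiv.Perm (Fin (n + 1)) => ∀ B ∈ CycleForm.orbits σ, B ∈ 𝒰),
      (-1 : ℝ) ^ ((CycleForm.orbits σ).card - 1) * ∏ B ∈ CycleForm.orbits σ, (if B ∈ 𝒰 then (1 : ℝ) else 0) =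
        (-1 : ℝ) ^ ((CycleForm.orbits σ).card - 1) := by
    intro σ hσ
    rw [prod_eq_one fun B hB => if_pos ((mem_filter.1 hσ).2 B hB), mul_one]
  have hout : ∀ σ ∈ univ.filter (fun σ : Equiv.Perm (Fin (n + 1)) => ¬ ∀ B ∈ CycleForm.orbits σ, B ∈ 𝒰),
      (-1 : ℝ) ^ ((CycleForm.orbits σ).card - 1) * ∏ B ∈ CycleForm.orbits σ, (if B ∈ 𝒰 then (1 : ℝ) else 0) = 0 := by
    intro σ hσ
    have hex : ∃ B ∈ CycleForm.orbits σ, B ∉ 𝒰 := by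
      have h2 := (mem_filter.1 hσ).2
      push Not at h2
      exact h2
    obtain ⟨B, hB, hBU⟩ := hex
    rw [prod_eq_zero hB (if_neg hBU), mul_zero]
  rw [sum_congr rfl hin, sum_congr rfl hout, sum_const_zero, add_zero] at h
  exact h

/-- **Set-partition form of (V′)** (the census lane's `Psi`): for a family `𝒰` of subsets of `Fin (n+1)` containing `univ` and
closed under disjoint unions, `0 ≤ Σ_{π ⊢ [n+1] : every block ∈ 𝒰} (−1)^{|π|−1} ∏_{B∈π} (|B|−1)!`. [this work] -/
theorem sum_setPartition_sign_nonneg_of_disjUnionClosed (𝒰 : Finset (Finset (Fin (n + 1))))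
    (hU : ∀ A ∈ 𝒰, ∀ B ∈ 𝒰, Disjoint A B → A ∪ B ∈ 𝒰) (htop : univ ∈ 𝒰) :
    0 ≤ ∑ c ∈ (univ : Finset (OrderedFinpartition (n + 1))).filter (fun c => ∀ j, PartitionForm.block c j ∈ 𝒰),
      (-1 : ℝ) ^ (c.length - 1) * ∏ j : Fin c.length, ((c.partSize j - 1).factorial : ℝ) := by
  have h := phiSet_indicator_nonneg_of_disjUnionClosed (Nat.succ_le_succ (Nat.zero_le n)) 𝒰 hU htop
  unfold PrincipalCapBeta.phiSet at h
  rw [← sum_filter_add_sum_filter_not univ (fun c : OrderedFinpartition (n + 1) => ∀ j, PartitionForm.block c j ∈ 𝒰)] at h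
  have hin : ∀ c ∈ univ.filter (fun c : OrderedFinpartition (n + 1) => ∀ j, PartitionForm.block c j ∈ 𝒰),
      (-1 : ℝ) ^ (c.length - 1) * ∏ j : Fin c.length, (((c.partSize j - 1).factorial : ℝ) *
        (if PartitionForm.block c j ∈ 𝒰 then (1 : ℝ) else 0)) =
      (-1 : ℝ) ^ (c.length - 1) * ∏ j : Fin c.length, ((c.partSize j - 1).factorial : ℝ) := by
    intro c hc
    refine congrArg _ (prod_congr rfl fun j _ => ?_)
    rw [if_pos ((mem_filter.1 hc).2 j), mul_one]
  have hout : ∀ c ∈ univ.filter (fun c : OrderedFinpartition (n + 1) => ¬ ∀ j, PartitionForm.block c j ∈ 𝒰),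
      (-1 : ℝ) ^ (c.length - 1) * ∏ j : Fin c.length, (((c.partSize j - 1).factorial : ℝ) *
        (if PartitionForm.block c j ∈ 𝒰 then (1 : ℝ) else 0)) = 0 := by
    intro c hc
    obtain ⟨j, hj⟩ : ∃ j, PartitionForm.block c j ∉ 𝒰 := not_forall.1 (mem_filter.1 hc).2
    rw [prod_eq_zero (mem_univ j) (by rw [if_neg hj, mul_zero]), mul_zero]
  rw [sum_congr rfl hin, sum_congr rfl hout, sum_const_zero, add_zero] at h
  exact h

end PhiVertexDisjoint

end Summit.CriticalPhenomena.PercolationContinuityZ3.Theorems
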